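/-
Copyright (c) 2026 the pub-hodgecm-mathlib formalisation cell (harness21).  Prover seat hodgecm-mathlib-F0P3a-p08 (g18): road «S3-tree» ROUTE (A) «SHALIKA» (LEAD F0P3a-plan
(g12), architect A-p16 (g30) ruling A-98 (1); END F0P3a-p03 (g15) contract v5 `stub_rankCM`), organ ‹RANK› — the CM head; 2026-09-01.
-/
import Literature.NumberTheory.Rogawski1990.UnipotentLevelPiecesFrameCM                  -- ★ p846498 (this seat) FILE 2a: the frame `ψ = T·e(·)·T⁻¹`, `K_std` ∕ token ∕ classes ∕ unipotency through `ψ`; brings ★ FILE 1, FILE 0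
import Literature.NumberTheory.Automorphic.OrbitalIntegralIndicatorSeparation          -- ★ p846366 (this lineage) the abstract RANK head `det_classOrbitalIntegral_indicator_ne_zero`
import Literature.NumberTheory.LocalFields.UnramifiedQuadraticNormAtInertPlaceValued   -- ★ p846530 (this seat): units of `L⁺_v` are norms ∕ a `σ_w`-skew unit, in `Valued.v` currency (over ★ `exists_mul_galAdicCompletionMap_eq_of_inert`)
import Literature.NumberTheory.Automorphic.FiniteAdeleFactorizable                     -- ★ `isClopen_setOf_valued_le` (closed valuation balls of `L_w` are clopen)
import HarnessLib

/-!
# RANK — THE U(3) INSTANTIATION: reference pieces of hyperspecial level ≤ 2 whose unipotent orbital integrals form an invertible matrix (the CM head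
# `stub_rankCM` of END's contract v5), at an unramified non-split place of good reduction

Topic `NumberTheory/Rogawski1990`; namespace `Literature.NumberTheory.Rogawski1990`.  THEOREMS ONLY (no definition, no instance, no notation, no named fact, no `sorry`); kernel
lane.  Cell `pub/hodgecm-mathlib` (D-0151), crux H413 = `stmt-HodgeConjecture-24833`; road «S3-tree» ROUTE (A) «SHALIKA» (`stub_N6nsS3id ⟸ ‹SHALIKA› + GEN-χ(≤2) + ‹RANK› +
S3-res`; architect A-p16 A-84 (2)∕A-87 (1)∕A-98 (1); END F0P3a-p03 (g15) contract v5 `s3id_of_shalika_of_rank_of_le_two` over {`stub_rankCM`, `stub_le_two`}; reader ref5 R-106).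
THIS FILE PROVES `stub_rankCM`'s text VERBATIM as `exists_levelPieces_det_classOrbitalIntegral_ne_zero` (binder `h2` kept in position as `_h2`: no `v ∤ 2` is needed).
THE MATHEMATICS.  `K = U(H′)(𝒪_v)` hyperspecial; through the frame `ψ = T·e(·)·T⁻¹ : G′_v ≅ U(σ_w, J₀)(L_w)` (★ FILE 2a `UnipotentLevelPiecesFrameCM`) put `K(j) = {y ∈ K :
ψy ≡ 1 (𝔪_w^j)}`, `R = {y ∈ K : (ψy − 1)² ≢ 0 (𝔪_w)}`.  The unipotent classes of `G′_v` are FOUR — `1`, `tv⁻ = [n(ϖδ)]`, `tv⁺ = [n(δ)]` (`δ` a `σ_w`-skew unit; units of `L⁺_v` are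
norms at inert `w`), `reg` (★ FILE 1 `sq_zero_unipotent_cases`, ★ `exists_conj_eq_of_regular_unipotent`) — and with `P(1) = K(2)`, `P(tv⁻) = K(1)∖K(2)`, `P(tv⁺) = K∖K(1)`,
`P(reg) = R`, rank `0,1,2,3`, the table `(Φ_{mU}(u, 1_{P u′}))` is LOWER TRIANGULAR with non-zero diagonal: `1 ∉ K(1)∖K(2), K∖K(1), R`; transvection classes miss `R`
(`(g−1)² = 0`); **`tv⁻` misses `K∖K(1)`** (★ FILE 1 parity lemma «an integral conjugate of `n(t)`, `|t| = |ϖ|`, is `≡ 1 (𝔪)`»); `1 ∈ K(2)`, `n(ϖδ) ∈ K(1)∖K(2)`, `n(δ) ∈ K∖K(1)`,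
`u(1,−t₀) ∈ R`.  The pieces are clopen, inside `K`, `Ad K`- and left-`K(2)`-stable (★ FILE 0), so their indicators carry the PARTIAL HEAD's tokens verbatim, and ★
`det_classOrbitalIntegral_indicator_ne_zero` (p846366) gives `det ≠ 0`.
HONEST LABEL: HC_CM is proved only modulo the 2 remaining named inputs (hLiu418 24832, h413 24833) until rung 0 closes; nothing printed is asserted here; `stub_N6nsS3id` stays a
print row until the road's END lands (this file discharges the `hrank` seam only).

* **`exists_levelPieces_det_classOrbitalIntegral_ne_zero`** — `stub_rankCM` (contract v5 :52–:83) VERBATIM.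

## References
* [Rogawski1990] J. D. Rogawski, *Automorphic Representations of Unitary Groups in Three Variables*, Ann. of Math. Stud. 123 (1990), §8.1 pp. 112–114; §3.9 Prop. 3.9.1 p. 32; §4.9 p. 54.
* [HarishChandra1999AdmissibleDistributions] Harish-Chandra, *Admissible Invariant Distributions on Reductive p-adic Groups*, AMS ULS 16 (1999), §3.1 p. 17.
* [Serre1979] J.-P. Serre, *Local Fields*, GTM 67 (1979), Ch. V §2 Prop. 3 (`U_F = N U_E`, unramified).
-/

set_option autoImplicit false

noncomputable section

open scoped WithZero Matrix MatrixGroups ValuativeRel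
open Topology Set NumberField IsDedekindDomain Matrix MeasureTheory

namespace Literature.NumberTheory.Rogawski1990

open Literature.NumberTheory.Automorphic Literature.NumberTheory.Automorphic.UnitaryGroup Literature.NumberTheory.GaloisRepresentations
open Literature.NumberTheory.Automorphic.UnitaryLatticeTree Literature.NumberTheory.Automorphic.HermitianLattice Literature.MeasureTheory.Group
open Literature.NumberTheory.LocalFields.UnramifiedQuadraticNorm

set_option maxHeartbeats 1600000 in
open scoped Classical in
/-- **‹RANK›, CM INSTANTIATION** (`stub_rankCM` of END's contract v5, holder F0P3a-p08 (g18), A-98 (1)): at a non-split place `v` unramified in `L` with `H′_w ∈ GL₃(𝒪_w)`, for every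
finite set `S` of UNIPOTENT classes of `U(H′)(L⁺_v)` and every orbital-measure family `mU` admissible on `S` with the Rao clause (the `∃`-data of ★ `ShalikaGermExpansionNonsplit`),
there are reference pieces `g_u ∈ C_c^∞` (`u ∈ S`) supported in the hyperspecial `K`, `Ad K`-invariant, left-invariant under the level-2 congruence set, with
`det (Φ_{mU}(u, g_{u′}))_{u,u′ ∈ S} ≠ 0` — the pieces `1_{K(2)}, 1_{K(1)∖K(2)}, 1_{K∖K(1)}, 1_R` by the class's type, lower-triangular in the closure order (★ p846366).
[cite: Rogawski1990, §8.1 Prop. 8.1.2 p. 114; §3.9 Prop. 3.9.1 p. 32; §4.9 p. 54] [cite: HarishChandra1999AdmissibleDistributions, §3.1 p. 17] [cite: Serre1979, Ch. V §2 Prop. 3] -/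
theorem exists_levelPieces_det_classOrbitalIntegral_ne_zero
    (L : Type) [Field L] [NumberField L] [IsCMField L] (H' : Matrix (Fin 3) (Fin 3) L)
    {v : HeightOneSpectrum (𝓞 ↥(maximalRealSubfield L))}
    (hH' : (H'.map (cmConjRingHom L)).transpose = H') (w : PlacesOver L v)
    (hw : IsCMField.complexConj L • w.1 = w.1) (hv : Algebra.IsUnramifiedIn (𝓞 L) v.asIdeal)
    (hH'w : IsUnit (placeForm H' w.1)) (hH'i : hH'w.unit ∈ glInt 3 (w.1.adicCompletion L))
    (_h2 : IsUnit (2 : 𝒪[w.1.adicCompletion L]))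
    [MeasurableSpace ((cmDatum L 3 H').Local v)] [BorelSpace ((cmDatum L 3 H').Local v)]
    [∀ γ : ((cmDatum L 3 H').Local v), MeasurableSpace (((cmDatum L 3 H').Local v) ⧸ Subgroup.centralizer ({γ} : Set ((cmDatum L 3 H').Local v)))]
    [∀ γ : ((cmDatum L 3 H').Local v), BorelSpace (((cmDatum L 3 H').Local v) ⧸ Subgroup.centralizer ({γ} : Set ((cmDatum L 3 H').Local v)))]
    -- the unipotent datum: conjuncts (i)–(iii) of ★ `ShalikaGermExpansionNonsplit` VERBATIM
    (S : Finset (ConjClasses ((cmDatum L 3 H').Local v)))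
    (hS : ∀ u ∈ S, (((Quotient.out u : (cmDatum L 3 H').Local v).val : GL (Fin 3) (UnitaryGroup.LocalRing L v)).val - 1) ^ 3 = 0)
    (mU : OrbitalMeasureFamily ((cmDatum L 3 H').Local v)) (hmU : mU.IsAdmissibleOn (fun γ => (ConjClasses.mk γ) ∈ S))
    (hRao : ∀ u ∈ S, ∀ f : (cmDatum L 3 H').Local v → ℂ, IsLocSmooth f →
      Integrable (descConj (Quotient.out u : (cmDatum L 3 H').Local v)
        (Subgroup.centralizer ({(Quotient.out u : (cmDatum L 3 H').Local v)} : Set ((cmDatum L 3 H').Local v)))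
        (fun _ hg => Subgroup.mem_centralizer_singleton_iff.1 hg) f) (mU u)) :
    ∃ gref : ↥S → ((cmDatum L 3 H').Local v) → ℂ,
      (∀ i, IsLocSmooth (gref i)) ∧
      (∀ i, tsupport (gref i) ⊆ (cmLocalIntegralLevel L 3 H' v : Set ((cmDatum L 3 H').Local v))) ∧
      (∀ i, ∀ u ∈ cmLocalIntegralLevel L 3 H' v, ∀ x, gref i (u * x * u⁻¹) = gref i x) ∧
      (∀ i, ∀ u : (cmDatum L 3 H').Local v,
        (∀ a b, Valued.v (((toPlace v w (HeckeCharacter.uniformizer ↥(maximalRealSubfield L) v : v.adicCompletion ↥(maximalRealSubfield L))) ^ 2)⁻¹ *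
          ((((localNonsplitEquiv (IsCMField.complexConj L) H' (IsCMField.complexConj_ne_one L) w hw u :
              ↥(unitaryGroupOfForm (galAdicCompletionMap (L := L) (IsCMField.complexConj L) hw) (placeForm H' w.1))) : GL (Fin 3) (w.1.adicCompletion L)) :
                Matrix (Fin 3) (Fin 3) (w.1.adicCompletion L)) a b - (1 : Matrix (Fin 3) (Fin 3) (w.1.adicCompletion L)) a b)) ≤ 1) →
        ∀ x, gref i (u * x) = gref i x) ∧
      (Matrix.of fun u u' : ↥S => classOrbitalIntegral mU (gref u') u).det ≠ 0 := by
  classical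
  -- ## 0. The frame `ψ = T·e(·)·T⁻¹ : G′_v → U(σ_w, J₀)(L_w)` (★ FILE 2a) and the unramified datum at `w`
  obtain ⟨T, hTint, hT⟩ := exists_glInt_placeForm_eq_formCongr_antidiagonal_of_isUnramifiedIn (↥(maximalRealSubfield L)) L (IsCMField.complexConj L)
    (IsCMField.complexConj_ne_one L) 3 H' hH' v w hw hv hH'w hH'i
  obtain ⟨ψ, hψ⟩ : ∃ ψ : (cmDatum L 3 H').Local v → GL (Fin 3) (w.1.adicCompletion L), ∀ y, ψ y =
      T * ((localNonsplitEquiv (IsCMField.complexConj L) H' (IsCMField.complexConj_ne_one L) w hw y :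
        ↥(unitaryGroupOfForm (galAdicCompletionMap (L := L) (IsCMField.complexConj L) hw) (placeForm H' w.1))) : GL (Fin 3) (w.1.adicCompletion L)) * T⁻¹ :=
    ⟨_, fun _ => rfl⟩
  -- the `ψ`-dictionary (★ FILE 2a, rewritten through `hψ`)
  have hψU : ∀ y, ψ y ∈ unitaryGroupOfForm (galAdicCompletionMap (L := L) (IsCMField.complexConj L) hw) ((StdForm.antidiagonal 3).over (w.1.adicCompletion L)) :=
    fun y => by rw [hψ]; exact conj_localNonsplitEquiv_mem L H' v w hw hT y
  have hψmul : ∀ y y', ψ (y * y') = ψ y * ψ y' := fun y y' => by simp only [hψ]; exact conj_localNonsplitEquiv_mul L H' v w hw y y'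
  have hψinv : ∀ y, ψ y⁻¹ = (ψ y)⁻¹ := fun y => by simp only [hψ]; exact conj_localNonsplitEquiv_inv L H' v w hw y
  have hψsurj : ∀ g ∈ unitaryGroupOfForm (galAdicCompletionMap (L := L) (IsCMField.complexConj L) hw) ((StdForm.antidiagonal 3).over (w.1.adicCompletion L)),
      ∃ y, ψ y = g := fun g hg => by simp only [hψ]; exact exists_conj_localNonsplitEquiv_eq L H' v w hw hT hg
  have hψK : ∀ y, y ∈ cmLocalIntegralLevel L 3 H' v ↔ IsIntMatrix ((ψ y : GL (Fin 3) (w.1.adicCompletion L)) : Matrix (Fin 3) (Fin 3) (w.1.adicCompletion L)) :=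
    fun y => by rw [hψ]; exact mem_cmLocalIntegralLevel_iff_isIntMatrix_conj L H' v w hw hT hTint y
  have hψconj : ∀ y y', ConjClasses.mk y = ConjClasses.mk y' ↔
      ∃ k : GL (Fin 3) (w.1.adicCompletion L), k ∈ unitaryGroupOfForm (galAdicCompletionMap (L := L) (IsCMField.complexConj L) hw)
        ((StdForm.antidiagonal 3).over (w.1.adicCompletion L)) ∧ k * ψ y * k⁻¹ = ψ y' :=
    fun y y' => by simp only [hψ]; exact conjClasses_mk_eq_iff_exists_conj L H' v w hw hT y y'
  have hψcont : ∀ a b, Continuous fun y => ((ψ y : GL (Fin 3) (w.1.adicCompletion L)) : Matrix (Fin 3) (Fin 3) (w.1.adicCompletion L)) a b := fun a b => by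
    simp only [hψ]; exact continuous_conj_localNonsplitEquiv_apply L H' v w hw a b
  have hψnil : ∀ u ∈ S, (((ψ (Quotient.out u) : GL (Fin 3) (w.1.adicCompletion L)) : Matrix (Fin 3) (Fin 3) (w.1.adicCompletion L)) - 1) ^ 3 = 0 :=
    fun u hu => by rw [hψ]; exact conj_localNonsplitEquiv_sub_one_pow_eq_zero L H' v w hw (hS u hu)
  have hout : ∀ c : ConjClasses ((cmDatum L 3 H').Local v), ConjClasses.mk (Quotient.out c) = c := fun c => by
    rw [← ConjClasses.quotient_mk_eq_mk, Quotient.out_eq]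
  -- the unramified datum at `w`: `σ_w` an involution preserving `|·|_w`, a `σ_w`-fixed uniformiser, (trace); units of `L⁺_v` are norms; a `σ_w`-skew unit `δ`
  obtain ⟨ϖ, hd⟩ := unramifiedLocalConjDatum_adicCompletion (IsCMField.complexConj L) (IsCMField.complexConj_ne_one L) v w hw hv
  have hcc : IsCMField.complexConj L * IsCMField.complexConj L = 1 := AlgEquiv.ext fun y => IsCMField.complexConj_apply_apply L y
  have hnormU : ∀ x : w.1.adicCompletion L, galAdicCompletionMap (L := L) (IsCMField.complexConj L) hw x = x → Valued.v x = 1 →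
      ∃ z : w.1.adicCompletion L, z * galAdicCompletionMap (L := L) (IsCMField.complexConj L) hw z = x := fun x hσx hvx =>
    exists_mul_galAdicCompletionMap_eq_of_valued_eq_one (IsCMField.complexConj L) v (IsCMField.complexConj_ne_one L) hcc hv w hw hσx hvx
  obtain ⟨δ, hσδ, hvδ⟩ := exists_galAdicCompletionMap_eq_neg_valued_eq_one (IsCMField.complexConj L) v (IsCMField.complexConj_ne_one L) hcc hv w hw
  obtain ⟨t₀, ht₀, htr⟩ := hd.trace
  haveI : CharZero (w.1.adicCompletion L) := charZero_of_injective_algebraMap (algebraMap L _).injective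
  have h2K : (2 : w.1.adicCompletion L) ≠ 0 := two_ne_zero
  -- the representatives `n₀ = n(δ)`, `n₁ = n(ϖδ)`, `u_reg = u(1, −t₀)` in `U(σ_w, J₀)(L_w)`
  obtain ⟨n₀, hn₀⟩ := exists_units_coe_eq_cornerUnipotent' δ
  obtain ⟨n₁, hn₁⟩ := exists_units_coe_eq_cornerUnipotent' (ϖ * δ)
  obtain ⟨ur, hur, -⟩ := exists_units_coe_eq_upperTriangularUnipotent (1 : w.1.adicCompletion L) (-t₀) (-1)
  obtain ⟨IsCj, hIsCj⟩ : ∃ IsCj : GL (Fin 3) (w.1.adicCompletion L) → GL (Fin 3) (w.1.adicCompletion L) → Prop, ∀ g n, IsCj g n ↔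
      ∃ k : GL (Fin 3) (w.1.adicCompletion L), k ∈ unitaryGroupOfForm (galAdicCompletionMap (L := L) (IsCMField.complexConj L) hw) ((StdForm.antidiagonal 3).over (w.1.adicCompletion L)) ∧ k * g * k⁻¹ = n := ⟨_, fun _ _ => Iff.rfl⟩
  have hσ1 : galAdicCompletionMap (L := L) (IsCMField.complexConj L) hw (ϖ * δ) = -(ϖ * δ) := by rw [map_mul, hd.σϖ, hσδ, mul_neg]
  have hv1 : Valued.v (ϖ * δ) = WithZero.exp (-1 : ℤ) := by rw [map_mul, hd.vϖ, hvδ, mul_one]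
  have hn₀U : n₀ ∈ unitaryGroupOfForm (galAdicCompletionMap (L := L) (IsCMField.complexConj L) hw) ((StdForm.antidiagonal 3).over (w.1.adicCompletion L)) :=
    (mem_unitaryGroupOfForm_iff_of_coe_eq_cornerUnipotent _ hn₀).2 (by rw [hσδ, neg_add_cancel])
  have hn₁U : n₁ ∈ unitaryGroupOfForm (galAdicCompletionMap (L := L) (IsCMField.complexConj L) hw) ((StdForm.antidiagonal 3).over (w.1.adicCompletion L)) :=
    (mem_unitaryGroupOfForm_iff_of_coe_eq_cornerUnipotent _ hn₁).2 (by rw [hσ1, neg_add_cancel])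
  obtain ⟨hurU, hurint, -, hurreg, hurnil⟩ := upperUnipotentOne_facts (galAdicCompletionMap (L := L) (IsCMField.complexConj L) hw) hd.σσ ht₀ htr hur
  have hexp21 : WithZero.exp (-2 : ℤ) ≤ WithZero.exp (-1 : ℤ) := WithZero.exp_le_exp.2 (by norm_num)
  have hexp20 : WithZero.exp (-2 : ℤ) ≤ (1 : ℤᵐ⁰) := by rw [← WithZero.exp_zero]; exact WithZero.exp_le_exp.2 (by norm_num)
  have hexp1lt : WithZero.exp (-1 : ℤ) < (1 : ℤᵐ⁰) := by rw [← WithZero.exp_zero]; exact WithZero.exp_lt_exp.2 (by norm_num)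
  -- ## 1. The level predicates through `ψ` and the rank of a class
  obtain ⟨lev, hlev⟩ : ∃ lev : ℤ → (cmDatum L 3 H').Local v → Prop, ∀ m y, lev m y ↔
      ∀ a b, Valued.v ((((ψ y : GL (Fin 3) (w.1.adicCompletion L)) : Matrix (Fin 3) (Fin 3) (w.1.adicCompletion L)) - 1) a b) ≤ WithZero.exp m := ⟨_, fun _ _ => Iff.rfl⟩
  obtain ⟨sq1, hsq1⟩ : ∃ sq1 : (cmDatum L 3 H').Local v → Prop, ∀ y, sq1 y ↔
      ∀ a b, Valued.v (((((ψ y : GL (Fin 3) (w.1.adicCompletion L)) : Matrix (Fin 3) (Fin 3) (w.1.adicCompletion L)) - 1) *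
        (((ψ y : GL (Fin 3) (w.1.adicCompletion L)) : Matrix (Fin 3) (Fin 3) (w.1.adicCompletion L)) - 1)) a b) ≤ WithZero.exp (-1 : ℤ) := ⟨_, fun _ => Iff.rfl⟩
  obtain ⟨b, hb⟩ : ∃ b : ConjClasses ((cmDatum L 3 H').Local v) → ℕ, ∀ c, b c =
      if ψ (Quotient.out c) = 1 then 0 else if IsCj (ψ (Quotient.out c)) n₁ then 1 else if IsCj (ψ (Quotient.out c)) n₀ then 2 else 3 := ⟨_, fun _ => rfl⟩
  obtain ⟨P, hP⟩ : ∃ P : ConjClasses ((cmDatum L 3 H').Local v) → Set ((cmDatum L 3 H').Local v), ∀ c, P c =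
      if b c = 0 then {y | y ∈ cmLocalIntegralLevel L 3 H' v ∧ lev (-2) y}
      else if b c = 1 then {y | y ∈ cmLocalIntegralLevel L 3 H' v ∧ lev (-1) y ∧ ¬ lev (-2) y}
      else if b c = 2 then {y | y ∈ cmLocalIntegralLevel L 3 H' v ∧ ¬ lev (-1) y}
      else {y | y ∈ cmLocalIntegralLevel L 3 H' v ∧ ¬ sq1 y} := ⟨_, fun _ => rfl⟩
  -- ## 2. Topology and invariance of the level sets
  obtain ⟨hKc, hKo⟩ := isCompact_isOpen_cmLocalIntegralLevel L 3 H' v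
  have hKcl : IsClosed (cmLocalIntegralLevel L 3 H' v : Set ((cmDatum L 3 H').Local v)) := (cmLocalIntegralLevel L 3 H' v).isClosed_of_isOpen hKo
  have hball : ∀ m : ℤ, IsClopen {x : w.1.adicCompletion L | Valued.v x ≤ WithZero.exp m} := fun m =>
    isClopen_setOf_valued_le L w.1 WithZero.exp_ne_zero
  have hψcontM : Continuous fun y => ((ψ y : GL (Fin 3) (w.1.adicCompletion L)) : Matrix (Fin 3) (Fin 3) (w.1.adicCompletion L)) :=
    continuous_pi fun a => continuous_pi fun c => hψcont a c
  have hlev_clopen : ∀ m, IsClopen {y | lev m y} := by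
    intro m
    have hset : {y | lev m y} = ⋂ a : Fin 3, ⋂ c : Fin 3,
        (fun y => ((((ψ y : GL (Fin 3) (w.1.adicCompletion L)) : Matrix (Fin 3) (Fin 3) (w.1.adicCompletion L)) - 1) a c)) ⁻¹'
          {x : w.1.adicCompletion L | Valued.v x ≤ WithZero.exp m} := by
      ext y; simp only [Set.mem_setOf_eq, hlev, Set.mem_iInter, Set.mem_preimage]
    rw [hset]
    exact isClopen_iInter_of_finite fun a => isClopen_iInter_of_finite fun c => (hball m).preimage ((hψcontM.sub continuous_const).matrix_elem a c)
  have hsq1_clopen : IsClopen {y | sq1 y} := by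
    have hset : {y | sq1 y} = ⋂ a : Fin 3, ⋂ c : Fin 3,
        (fun y => (((((ψ y : GL (Fin 3) (w.1.adicCompletion L)) : Matrix (Fin 3) (Fin 3) (w.1.adicCompletion L)) - 1) *
          (((ψ y : GL (Fin 3) (w.1.adicCompletion L)) : Matrix (Fin 3) (Fin 3) (w.1.adicCompletion L)) - 1)) a c)) ⁻¹'
          {x : w.1.adicCompletion L | Valued.v x ≤ WithZero.exp (-1 : ℤ)} := by
      ext y; simp only [Set.mem_setOf_eq, hsq1, Set.mem_iInter, Set.mem_preimage]
    rw [hset]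
    exact isClopen_iInter_of_finite fun a => isClopen_iInter_of_finite fun c =>
      (hball (-1)).preimage (((hψcontM.sub continuous_const).mul (hψcontM.sub continuous_const)).matrix_elem a c)
  -- `Ad K`-invariance and left-`K(2)`-invariance of the basic predicates (★ FILE 0)
  have hconjK : ∀ k ∈ cmLocalIntegralLevel L 3 H' v, ∀ y, k * y * k⁻¹ ∈ cmLocalIntegralLevel L 3 H' v ↔ y ∈ cmLocalIntegralLevel L 3 H' v := by
    intro k hk y
    refine ⟨fun h => ?_, fun h => mul_mem (mul_mem hk h) (inv_mem hk)⟩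
    have h' := mul_mem (mul_mem (inv_mem hk) h) hk
    rwa [show k⁻¹ * (k * y * k⁻¹) * k = y by group] at h'
  have hψKinv : ∀ k ∈ cmLocalIntegralLevel L 3 H' v,
      IsIntMatrix (((ψ k)⁻¹ : GL (Fin 3) (w.1.adicCompletion L)) : Matrix (Fin 3) (Fin 3) (w.1.adicCompletion L)) := fun k hk => by
    rw [← hψinv]; exact (hψK k⁻¹).1 (inv_mem hk)
  have hconj_lev : ∀ k ∈ cmLocalIntegralLevel L 3 H' v, ∀ m y, lev m (k * y * k⁻¹) ↔ lev m y := by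
    intro k hk m y
    rw [hlev, hlev, hψmul, hψmul, hψinv]
    exact forall_v_conj_sub_one_apply_le_iff ((hψK k).1 hk) (hψKinv k hk) (ψ y) _
  have hconj_sq1 : ∀ k ∈ cmLocalIntegralLevel L 3 H' v, ∀ y, sq1 (k * y * k⁻¹) ↔ sq1 y := by
    intro k hk y
    rw [hsq1, hsq1, hψmul, hψmul, hψinv]
    exact forall_v_conj_sub_one_sq_apply_le_iff ((hψK k).1 hk) (hψKinv k hk) (ψ y) _
  have hmulK : ∀ u ∈ cmLocalIntegralLevel L 3 H' v, ∀ y, u * y ∈ cmLocalIntegralLevel L 3 H' v ↔ y ∈ cmLocalIntegralLevel L 3 H' v :=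
    fun u hu y => Subgroup.mul_mem_cancel_left _ hu
  have hmul_lev : ∀ u, lev (-2) u → ∀ y ∈ cmLocalIntegralLevel L 3 H' v, ∀ m, m = -1 ∨ m = -2 → (lev m (u * y) ↔ lev m y) := by
    intro u hu2 y hy m hm
    rw [hlev, hlev, hψmul]
    refine forall_v_mul_sub_one_apply_le_iff ((hlev (-2) u).1 hu2) ((hψK y).1 hy) ?_
    rcases hm with rfl | rfl <;> [exact hexp21; exact le_rfl]
  have hmul_sq1 : ∀ u, lev (-2) u → ∀ y ∈ cmLocalIntegralLevel L 3 H' v, (sq1 (u * y) ↔ sq1 y) := by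
    intro u hu2 y hy
    rw [hsq1, hsq1, hψmul]
    exact forall_v_mul_sub_one_sq_apply_le_iff ((hlev (-2) u).1 hu2) ((hψK y).1 hy) hexp21 hexp20
  -- the pieces: clopen, inside `K`, `Ad K`-stable, left-`K(2)`-stable
  have hPK : ∀ c, P c ⊆ (cmLocalIntegralLevel L 3 H' v : Set ((cmDatum L 3 H').Local v)) := fun c y hy => by
    rw [hP c] at hy; split_ifs at hy <;> exact hy.1
  have hKclopen : IsClopen (cmLocalIntegralLevel L 3 H' v : Set ((cmDatum L 3 H').Local v)) := ⟨hKcl, hKo⟩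
  have hPclopen : ∀ c, IsClopen (P c) := fun c => by
    rw [hP c]; split_ifs
    · exact hKclopen.inter (hlev_clopen (-2))
    · exact hKclopen.inter ((hlev_clopen (-1)).inter (hlev_clopen (-2)).compl)
    · exact hKclopen.inter (hlev_clopen (-1)).compl
    · exact hKclopen.inter hsq1_clopen.compl
  have hPo : ∀ c ∈ S, IsOpen (P c) := fun c _ => (hPclopen c).isOpen
  have hPcl : ∀ c ∈ S, IsClosed (P c) := fun c _ => (hPclopen c).isClosed
  have hPc : ∀ c ∈ S, IsCompact (P c) := fun c _ => hKc.of_isClosed_subset (hPclopen c).isClosed (hPK c)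
  have hPconj : ∀ c, ∀ k ∈ cmLocalIntegralLevel L 3 H' v, ∀ y, k * y * k⁻¹ ∈ P c ↔ y ∈ P c := fun c k hk y => by
    rw [hP c]; split_ifs <;> simp only [Set.mem_setOf_eq, hconjK k hk, hconj_lev k hk, hconj_sq1 k hk]
  -- left translation: the level conjuncts are read only inside `K`
  have hand : ∀ (p : (cmDatum L 3 H').Local v → Prop) (u : (cmDatum L 3 H').Local v), u ∈ cmLocalIntegralLevel L 3 H' v →
      (∀ y ∈ cmLocalIntegralLevel L 3 H' v, (p (u * y) ↔ p y)) →
      ∀ y, (u * y ∈ cmLocalIntegralLevel L 3 H' v ∧ p (u * y) ↔ y ∈ cmLocalIntegralLevel L 3 H' v ∧ p y) := fun p u huK hp y =>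
    ⟨fun h => ⟨(hmulK u huK y).1 h.1, (hp y ((hmulK u huK y).1 h.1)).1 h.2⟩, fun h => ⟨(hmulK u huK y).2 h.1, (hp y h.1).2 h.2⟩⟩
  have hPmul : ∀ c, ∀ u, u ∈ cmLocalIntegralLevel L 3 H' v → lev (-2) u → ∀ y, u * y ∈ P c ↔ y ∈ P c := fun c u huK hu2 y => by
    rw [hP c]; split_ifs
    · exact hand _ u huK (fun y hy => hmul_lev u hu2 y hy (-2) (Or.inr rfl)) y
    · exact hand (fun y => lev (-1) y ∧ ¬ lev (-2) y) u huK
        (fun y hy => and_congr (hmul_lev u hu2 y hy (-1) (Or.inl rfl)) (not_congr (hmul_lev u hu2 y hy (-2) (Or.inr rfl)))) y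
    · exact hand (fun y => ¬ lev (-1) y) u huK (fun y hy => not_congr (hmul_lev u hu2 y hy (-1) (Or.inl rfl))) y
    · exact hand (fun y => ¬ sq1 y) u huK (fun y hy => not_congr (hmul_sq1 u hu2 y hy)) y
  -- ## 3. The rank: the four values and the classification (★ FILE 1)
  have hb_le : ∀ c, b c ≤ 3 := fun c => by rw [hb c]; split_ifs <;> omega
  have hb0 : ∀ c, b c = 0 ↔ ψ (Quotient.out c) = 1 := fun c => by
    rw [hb c]
    split_ifs with h0 <;> first | exact iff_of_true rfl h0 | exact iff_of_false (by decide) h0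
  have hb1 : ∀ c, b c = 1 ↔ ¬ ψ (Quotient.out c) = 1 ∧ IsCj (ψ (Quotient.out c)) n₁ := fun c => by
    rw [hb c]
    split_ifs with h0 h1 h2
    · exact iff_of_false (by decide) fun h => h.1 h0
    · exact iff_of_true rfl ⟨h0, h1⟩
    · exact iff_of_false (by decide) fun h => h1 h.2
    · exact iff_of_false (by decide) fun h => h1 h.2
  have hb2 : ∀ c, b c = 2 ↔ ¬ ψ (Quotient.out c) = 1 ∧ ¬ IsCj (ψ (Quotient.out c)) n₁ ∧ IsCj (ψ (Quotient.out c)) n₀ := fun c => by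
    rw [hb c]
    split_ifs with h0 h1 h2
    · exact iff_of_false (by decide) fun h => h.1 h0
    · exact iff_of_false (by decide) fun h => h.2.1 h1
    · exact iff_of_true rfl ⟨h0, h1, h2⟩
    · exact iff_of_false (by decide) fun h => h2 h.2.2
  -- the unipotent `ψ(out u)`, `u ∈ S`, is REGULAR when its rank is `3` (★ FILE 1 `sq_zero_unipotent_cases`)
  have hreg3 : ∀ u ∈ S, b u = 3 →
      (((ψ (Quotient.out u) : GL (Fin 3) (w.1.adicCompletion L)) : Matrix (Fin 3) (Fin 3) (w.1.adicCompletion L)) - 1) *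
        (((ψ (Quotient.out u) : GL (Fin 3) (w.1.adicCompletion L)) : Matrix (Fin 3) (Fin 3) (w.1.adicCompletion L)) - 1) ≠ 0 := by
    intro u _ h3 hsq
    have hbu := hb u
    split_ifs at hbu with h0 h1 h2 <;> try omega
    rcases sq_zero_unipotent_cases (galAdicCompletionMap (L := L) (IsCMField.complexConj L) hw) hd hnormU hσδ hvδ hn₀ hn₁ (hψU _) hsq with h | h | h
    · exact h0 h
    · exact h1 ((hIsCj _ _).2 h)
    · exact h2 ((hIsCj _ _).2 h)
  -- ## 4. The table: diagonal representatives and above-diagonal zeros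
  have hlev_one : ∀ y m, ψ y = 1 → lev m y := fun y m hy => by
    rw [hlev]; intro a c
    rw [hy, Units.val_one, sub_self, Matrix.zero_apply, map_zero]; exact zero_le
  have hPx : ∀ u ∈ S, ∃ x ∈ P u, ConjClasses.mk x = u := by
    intro u hu
    have hcases : b u = 0 ∨ b u = 1 ∨ b u = 2 ∨ b u = 3 := by have := hb_le u; omega
    rcases hcases with h0 | h1 | h2 | h3
    · -- the class of `1`: `x = out u` itself lies in `K(2)`
      have hψ1 := (hb0 u).1 h0
      refine ⟨Quotient.out u, ?_, hout u⟩
      rw [hP u, if_pos h0]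
      exact ⟨(hψK _).2 (by rw [hψ1, Units.val_one]; exact isIntMatrix_one), hlev_one _ _ hψ1⟩
    · -- `tv⁻`: `x = ψ⁻¹ n(ϖδ) ∈ K(1) ∖ K(2)`
      obtain ⟨k, hk, hkn⟩ := (hIsCj _ _).1 ((hb1 u).1 h1).2
      obtain ⟨x, hx⟩ := hψsurj n₁ hn₁U
      refine ⟨x, ?_, ?_⟩
      · rw [hP u, if_neg (by omega), if_pos h1]
        refine ⟨(hψK x).2 (by rw [hx]; exact isIntMatrix_cornerUnipotent (by rw [hv1]; exact hexp1lt.le) hn₁), (hlev _ _).2 ?_, fun h => ?_⟩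
        · rw [hx]; exact (forall_v_cornerUnipotent_sub_one_apply_le_iff hn₁ _).2 hv1.le
        · have h' := (forall_v_cornerUnipotent_sub_one_apply_le_iff hn₁ _).1 (by rw [← hx]; exact (hlev _ _).1 h)
          rw [hv1, WithZero.exp_le_exp] at h'
          omega
      · rw [← hout u, hψconj]
        exact ⟨k⁻¹, inv_mem hk, by rw [hx, ← hkn]; group⟩
    · -- `tv⁺`: `x = ψ⁻¹ n(δ) ∈ K ∖ K(1)`
      obtain ⟨k, hk, hkn⟩ := (hIsCj _ _).1 ((hb2 u).1 h2).2.2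
      obtain ⟨x, hx⟩ := hψsurj n₀ hn₀U
      refine ⟨x, ?_, ?_⟩
      · rw [hP u, if_neg (by omega), if_neg (by omega), if_pos h2]
        refine ⟨(hψK x).2 (by rw [hx]; exact isIntMatrix_cornerUnipotent hvδ.le hn₀), fun h => ?_⟩
        have h' := (forall_v_cornerUnipotent_sub_one_apply_le_iff hn₀ _).1 (by rw [← hx]; exact (hlev _ _).1 h)
        rw [hvδ, ← WithZero.exp_zero, WithZero.exp_le_exp] at h'
        omega
      · rw [← hout u, hψconj]
        exact ⟨k⁻¹, inv_mem hk, by rw [hx, ← hkn]; group⟩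
    · -- `reg`: `x = ψ⁻¹ u(1, −t₀) ∈ R` (ONE regular class, ★ `exists_conj_eq_of_regular_unipotent`)
      have hreg := hreg3 u hu h3
      obtain ⟨k, hk, hkr⟩ := exists_conj_eq_of_regular_unipotent (galAdicCompletionMap (L := L) (IsCMField.complexConj L) hw) hd.σσ h2K (hψU _) hurU
        ⟨3, hψnil u hu⟩ hurnil hreg hurreg
      obtain ⟨x, hx⟩ := hψsurj ur hurU
      refine ⟨x, ?_, ?_⟩
      · rw [hP u, if_neg (by omega), if_neg (by omega), if_neg (by omega)]
        exact ⟨(hψK x).2 (by rw [hx]; exact hurint), fun h => not_forall_v_upperUnipotentOne_sub_one_sq_apply_le hur hexp1lt (by rw [← hx]; exact (hsq1 x).1 h)⟩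
      · rw [← hout u, hψconj]
        exact ⟨k⁻¹, inv_mem hk, by rw [hx, ← hkr]; group⟩
  have hbinj : Set.InjOn b ↑S := by
    intro c hc c' hc' hcc'
    rw [Finset.mem_coe] at hc hc'
    suffices hk : IsCj (ψ (Quotient.out c)) (ψ (Quotient.out c')) by
      rw [← hout c, ← hout c']
      exact (hψconj _ _).2 ((hIsCj _ _).1 hk)
    rw [hIsCj]
    have hcases : b c = 0 ∨ b c = 1 ∨ b c = 2 ∨ b c = 3 := by have := hb_le c; omega
    rcases hcases with h0 | h1 | h2 | h3
    · refine ⟨1, one_mem _, ?_⟩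
      rw [(hb0 c).1 h0, (hb0 c').1 (by omega), mul_one, one_mul, inv_one]
    · obtain ⟨k, hk, hkn⟩ := (hIsCj _ _).1 ((hb1 c).1 h1).2
      obtain ⟨k', hk', hkn'⟩ := (hIsCj _ _).1 ((hb1 c').1 (by omega)).2
      refine ⟨k'⁻¹ * k, mul_mem (inv_mem hk') hk, ?_⟩
      rw [show k'⁻¹ * k * ψ (Quotient.out c) * (k'⁻¹ * k)⁻¹ = k'⁻¹ * (k * ψ (Quotient.out c) * k⁻¹) * k' by group, hkn, ← hkn']
      group
    · obtain ⟨k, hk, hkn⟩ := (hIsCj _ _).1 ((hb2 c).1 h2).2.2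
      obtain ⟨k', hk', hkn'⟩ := (hIsCj _ _).1 ((hb2 c').1 (by omega)).2.2
      refine ⟨k'⁻¹ * k, mul_mem (inv_mem hk') hk, ?_⟩
      rw [show k'⁻¹ * k * ψ (Quotient.out c) * (k'⁻¹ * k)⁻¹ = k'⁻¹ * (k * ψ (Quotient.out c) * k⁻¹) * k' by group, hkn, ← hkn']
      group
    · exact exists_conj_eq_of_regular_unipotent (galAdicCompletionMap (L := L) (IsCMField.complexConj L) hw) hd.σσ h2K (hψU _) (hψU _)
        ⟨3, hψnil c hc⟩ ⟨3, hψnil c' hc'⟩ (hreg3 c hc h3) (hreg3 c' hc' (by omega))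
  have hsep : ∀ u ∈ S, ∀ u' ∈ S, b u < b u' → ∀ y ∈ P u', ConjClasses.mk y ≠ u := by
    intro u hu u' _ hlt y hy hyu
    -- `y ∼ out u`: `ψ y = k ψ(out u) k⁻¹` with `k ∈ U(σ_w, J₀)`
    obtain ⟨k, hk, hky⟩ := (hψconj (Quotient.out u) y).1 (by rw [hout u, hyu])
    -- `ψ y` when `u` is the class of `1` ∕ of `n(ϖδ)` ∕ of `n(δ)`
    have hy1 : b u = 0 → ψ y = 1 := fun h0 => by rw [← hky, (hb0 u).1 h0, mul_one, mul_inv_cancel]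
    have hyn₁ : b u = 1 → ∃ k₁ : GL (Fin 3) (w.1.adicCompletion L), k₁ ∈ unitaryGroupOfForm (galAdicCompletionMap (L := L) (IsCMField.complexConj L) hw) ((StdForm.antidiagonal 3).over (w.1.adicCompletion L)) ∧
        ψ y = k₁ * n₁ * k₁⁻¹ := fun h1 => by
      obtain ⟨k₁, hk₁, hk₁n⟩ := (hIsCj _ _).1 ((hb1 u).1 h1).2
      exact ⟨k * k₁⁻¹, mul_mem hk (inv_mem hk₁), by rw [← hky, ← hk₁n]; group⟩
    have hyn₀ : b u = 2 → ∃ k₀ : GL (Fin 3) (w.1.adicCompletion L), ψ y = k₀ * n₀ * k₀⁻¹ := fun h2 => by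
      obtain ⟨k₀, -, hk₀n⟩ := (hIsCj _ _).1 ((hb2 u).1 h2).2.2
      exact ⟨k * k₀⁻¹, by rw [← hky, ← hk₀n]; group⟩
    rw [hP u'] at hy
    have hcases : b u' = 1 ∨ b u' = 2 ∨ b u' = 3 := by have := hb_le u'; omega
    rcases hcases with h1 | h2 | h3
    · -- `P u' = K(1) ∖ K(2)` misses the class of `1`
      rw [if_neg (by omega), if_pos h1, Set.mem_setOf_eq] at hy
      exact hy.2.2 (hlev_one y _ (hy1 (by omega)))
    · -- `P u' = K ∖ K(1)` misses the class of `1` and — THE PARITY ROW — the class of `n(ϖδ)`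
      rw [if_neg (by omega), if_neg (by omega), if_pos h2, Set.mem_setOf_eq] at hy
      apply hy.2
      have hbu : b u = 0 ∨ b u = 1 := by omega
      rcases hbu with h0 | h1
      · exact hlev_one y _ (hy1 h0)
      · obtain ⟨k₁, hk₁, hψy⟩ := hyn₁ h1
        have hint := (hψK y).1 hy.1
        rw [hlev, hψy]
        rw [hψy] at hint
        exact forall_v_conj_cornerUnipotent_sub_one_apply_le_exp_neg_one (galAdicCompletionMap (L := L) (IsCMField.complexConj L) hw) hd.vσ hv1 hn₁ hk₁ hint
    · -- `P u' = R` misses the classes of `1`, `n(ϖδ)`, `n(δ)` (all square-zero)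
      rw [if_neg (by omega), if_neg (by omega), if_neg (by omega), Set.mem_setOf_eq] at hy
      apply hy.2
      have hsq0 : (((ψ y : GL (Fin 3) (w.1.adicCompletion L)) : Matrix (Fin 3) (Fin 3) (w.1.adicCompletion L)) - 1) *
          (((ψ y : GL (Fin 3) (w.1.adicCompletion L)) : Matrix (Fin 3) (Fin 3) (w.1.adicCompletion L)) - 1) = 0 := by
        have hbu : b u = 0 ∨ b u = 1 ∨ b u = 2 := by omega
        rcases hbu with h0 | h1 | h2
        · rw [hy1 h0, Units.val_one, sub_self, Matrix.zero_mul]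
        · obtain ⟨k₁, -, hψy⟩ := hyn₁ h1
          rw [hψy]; exact conj_cornerUnipotent_sub_one_mul_self hn₁ _
        · obtain ⟨k₀, hψy⟩ := hyn₀ h2
          rw [hψy]; exact conj_cornerUnipotent_sub_one_mul_self hn₀ _
      rw [hsq1]
      intro a c
      rw [hsq0, Matrix.zero_apply, map_zero]; exact zero_le
  -- ## 5. Assembly
  refine ⟨fun u => (P u).indicator fun _ => (1 : ℂ), fun i => isLocSmooth_indicator (hPo i i.2) (hPcl i i.2) (hPc i i.2), fun i => ?_, fun i u hu x => ?_,
    fun i u hu x => ?_, det_classOrbitalIntegral_indicator_ne_zero S mU hmU hRao P hPo hPc hPcl hPx b hbinj hsep⟩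
  · -- support inside `K`
    exact hKcl.closure_subset_iff.2 (Set.support_indicator_subset.trans (hPK i))
  · -- `Ad K`-invariance
    show (P i).indicator (fun _ => (1 : ℂ)) (u * x * u⁻¹) = (P i).indicator (fun _ => (1 : ℂ)) x
    by_cases hx : x ∈ P i
    · rw [Set.indicator_of_mem hx, Set.indicator_of_mem ((hPconj i u hu x).2 hx)]
    · rw [Set.indicator_of_notMem hx, Set.indicator_of_notMem (fun h => hx ((hPconj i u hu x).1 h))]
  · -- left-invariance under the level-2 congruence set
    have huK := mem_cmLocalIntegralLevel_of_levelTwoToken L H' v w hw hT hv hTint hu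
    have hu2' : lev (-2) u := (hlev (-2) u).2 (by rw [hψ]; exact (forall_levelTwoToken_iff L H' v w hw hv hTint u).1 hu)
    show (P i).indicator (fun _ => (1 : ℂ)) (u * x) = (P i).indicator (fun _ => (1 : ℂ)) x
    by_cases hx : x ∈ P i
    · rw [Set.indicator_of_mem hx, Set.indicator_of_mem ((hPmul i u huK hu2' x).2 hx)]
    · rw [Set.indicator_of_notMem hx, Set.indicator_of_notMem (fun h => hx ((hPmul i u huK hu2' x).1 h))]

end Literature.NumberTheory.Rogawski1990

end
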